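/-
COR-CM (cell pub-hodgecm2, stage 2 of the Hodge ladder) — count-neutral kernel combinatorics (seat prover-pub-hodgecm2-b23-g51-0, binder
prover b23, gen 51; lane SYLOW TRANSFER, claim HOME/INBOX.md l.23329; blanket `Census/SylowTransfer*` l.23357).  Theorems only, in seat b09's
intrinsic model (consumed BY NAME, nothing restated); no definition, no certificate, no `decide`, no named fact, no geometry, no `sorry`.
`Interfaces.lean` (C1), every E term, B01 and `Transposition/*` are untouched.
HONEST FRAMING: `HC_CM` is NOT proved, here or anywhere in the tree; nothing here is a period or a headline.
-/
import Summits.HodgeConjecture.CorCM.Census.SylowTransferRoots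
import Summits.HodgeConjecture.CorCM.Census.IndexTwoCyclicTwoGroups
import Summits.HodgeConjecture.CorCM.Census.AbelianTwistDatum

/-!
# Sylow transfer, X: the excluded `2`-group cases — the element forms without «`P ≠ G`»

Parts II and VI assumed `P ≠ G` (`m > 1`: the transfer needs a non-trivial normal `2`-complement for seat b09ʼs kernel hypotheses).  When `G = P` is
itself the `2`-group the laws are older: `G` cyclic — gen 38ʼs cyclic law in gen 50ʼs `IsLeast` form (`IndexTwoCyclic.isLeast_card_gfaces_generate_fibreTwo_of_isCyclic`);
`G = ⟨u⟩ × ⟨x⟩ ≅ ℤ/2ᵏ × ℤ/2` — abelian (part Vʼs `comm_of_mem`), seat b09ʼs abelian law (`TwistGeneration.isLeast_card_gfaces_generate_of_comm`, `G : Type`).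
Hence the hypothesis `m ≠ 1` of the element forms can be DROPPED:
* **`isLeast_card_gfaces_generate_fibreTwo_of_orderOf_eq_two_pow'`** (`G : Type*`): `|G| = 2ᵏ·m`, `m` odd, `k ≥ 2`, some `u` of order `2ᵏ` ⟹ `μ = φ₂` for every
  central involution.
* **`isLeast_card_gfaces_generate_fibreTwo_of_cyclicTimesTwo_elements'`** (`G : Type`): `|G| = 2ᵏ⁺¹·m`, `m` odd, `k ≥ 2`, commuting `u` of order `2ᵏ` and an
  involution `x ∉ ⟨u⟩` ⟹ `μ = φ₂` for every central involution.
All [folklore] bookkeeping over [Pohlmann1968, Thm 1] in the reading of [Milne1999, Prop. 2.1].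

## References
* [Pohlmann1968] H. Pohlmann, Algebraic cycles on abelian varieties of complex multiplication type, Ann. of Math. 88 (1968), Thm 1.
* [Milne1999] J. S. Milne, Lefschetz motives and the Tate conjecture, Compositio Math. 117 (1999), Prop. 2.1, p. 54.
-/

namespace Summit.HodgeConjecture.CorCM.Census.SylowTransfer

open Finset
open Summit.HodgeConjecture.CorCM.Prior.AllgGroup.RfwfAllgGroup
open Summit.HodgeConjecture.CorCM.Census.BlockParity
open Summit.HodgeConjecture.CorCM.Census.Coinvariant

noncomputable section

/-- **Cyclic Sylow `2`-subgroup by an element of order the `2`-part, WITHOUT `m ≠ 1`** (`m = 1`: `G = ⟨u⟩` is cyclic). [folklore] -/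
theorem isLeast_card_gfaces_generate_fibreTwo_of_orderOf_eq_two_pow' {G : Type*} [Group G] [Fintype G] [DecidableEq G] (c : G) {k m : ℕ} (u : G)
    (hu : orderOf u = 2 ^ k) (hk : 2 ≤ k) (hG : Fintype.card G = 2 ^ k * m) (hm : Odd m) (hc2 : c * c = 1) (hc1 : c ≠ 1)
    (hcen : ∀ x : G, x * c = c * x) :
    IsLeast {n : ℕ | ∃ S : Finset (CMF G c →₀ ℤ), (↑S ⊆ gfaceSet G c hc2) ∧ S.card = n ∧
      hodgeSpan c hc2 ≤ Submodule.span ℤ (pairSet c) ⊔ Submodule.span ℤ (translates c S)} (fibreTwo c hc2) := by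
  by_cases hm1 : m = 1
  · subst hm1
    haveI : IsCyclic G := isCyclic_of_orderOf_eq_card u (by rw [hu, Nat.card_eq_fintype_card, hG, mul_one])
    exact IndexTwoCyclic.isLeast_card_gfaces_generate_fibreTwo_of_isCyclic hc2 hc1
  · exact (isLeast_card_gfaces_generate_fibreTwo_of_orderOf_eq_two_pow c u hu hk hG hm hm1 hc2 hc1 hcen).1

/-- **Sylow `ℤ/2ᵏ × ℤ/2` by elements, WITHOUT `m ≠ 1`** (`G : Type`; `m = 1`: `G = ⟨u⟩ × ⟨x⟩` is abelian, seat b09ʼs abelian law). [folklore] -/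
theorem isLeast_card_gfaces_generate_fibreTwo_of_cyclicTimesTwo_elements' {G : Type} [Group G] [Fintype G] [DecidableEq G] (c : G) {u x : G}
    {k m : ℕ} (hux : u * x = x * u) (hord : orderOf u = 2 ^ k) (hk : 2 ≤ k) (hx2 : x * x = 1) (hx1 : x ≠ 1) (hxu : x ∉ Subgroup.zpowers u)
    (hG : Fintype.card G = 2 ^ (k + 1) * m) (hm : Odd m) (hc2 : c * c = 1) (hc1 : c ≠ 1) (hcen : ∀ y : G, y * c = c * y) :
    IsLeast {n : ℕ | ∃ S : Finset (CMF G c →₀ ℤ), (↑S ⊆ gfaceSet G c hc2) ∧ S.card = n ∧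
      hodgeSpan c hc2 ≤ Submodule.span ℤ (pairSet c) ⊔ Submodule.span ℤ (translates c S)} (fibreTwo c hc2) := by
  by_cases hm1 : m = 1
  · subst hm1
    -- `G = ⟨u⟩ × ⟨x⟩` is abelian
    have hcard : Nat.card (⊤ : Subgroup G) = 2 * orderOf u := by rw [Subgroup.card_top, Nat.card_eq_fintype_card, hG, hord, mul_one, pow_succ']
    have hcomm : ∀ a b : G, a * b = b * a := fun a b =>
      comm_of_mem (P := ⊤) (Subgroup.mem_top u) (Subgroup.mem_top x) hxu hx2 hux hcard (Subgroup.mem_top a) (Subgroup.mem_top b)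
    letI : CommGroup G := { (inferInstance : Group G) with mul_comm := hcomm }
    exact TwistGeneration.isLeast_card_gfaces_generate_of_comm hc2 hc1
  · exact isLeast_card_gfaces_generate_fibreTwo_of_cyclicTimesTwo_elements c hux hord hk hx2 hx1 hxu hG hm hm1 hc2 hc1 hcen

end

end Summit.HodgeConjecture.CorCM.Census.SylowTransfer
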